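import Literature.Probability.LatticeModels.LatticeSineGordon

/-!
# Crux `AnchorGap` (stmt-QuantumFields-11141), line `registered` — Gaussian integration by parts (M-b toolkit under stub DSred)

The generic engine of every perturbative step around the Debye–Hückel reference Gaussian of
`…StubDebyeScreening11` (Wick's rule), absent from Mathlib and the tree in this form:

* `integral_partialDeriv_eq_zero` — on `ι → ℝ` with product Lebesgue measure, the integral of an
  everywhere-defined, integrable partial derivative of an integrable function vanishes (Fubini with
  the coordinate innermost, `MeasurableEquiv.piEquivPiSubtypeProd` + `funUnique`, and
  `integral_eq_zero_of_hasDerivAt_of_integrable` on the line);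
* `gaussian_ibp` — for a symmetric precision matrix `P`,
  `∫ (∂_q F) e^{−½φᵀPφ} dφ = ∫ F(φ) (Pφ)_q e^{−½φᵀPφ} dφ` under the natural integrability
  hypotheses (the derivative of the weight along `q` is `−(Pφ)_q e^{−½φᵀPφ}`, symmetric `P`).
  Multiplying by `P⁻¹` and summing over `q` gives `⟨φ_p F⟩ = Σ_q P⁻¹_{pq} ⟨∂_q F⟩`.

Inside the first proof the product measures on `{i // i = q} → ℝ` built from different `Fintype`
instances are identified by `Subsingleton.elim`.
-/

set_option autoImplicit false

noncomputable section

namespace Summit.QuantumFields.YangMills.Theorems.AnchorGap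

open MeasureTheory Finset Matrix

section

/-- **The integral of a partial derivative vanishes.** On `ι → ℝ` (finite `ι`, product Lebesgue
measure): if `G` is integrable, differentiable along the coordinate `q` with everywhere-defined
partial derivative `G'` (in the sense `HasDerivAt (t ↦ G(φ[q ↦ t])) (G' φ) (φ q)`), and `G'` is
integrable, then `∫ G' = 0` (Fubini over the coordinate `q`, and `∫_ℝ f' = 0` for integrable `f, f'`,
`integral_eq_zero_of_hasDerivAt_of_integrable`). [folklore] -/
theorem integral_partialDeriv_eq_zero :
    ∀ (ι : Type) [Fintype ι] [DecidableEq ι] (q : ι) (G G' : (ι → ℝ) → ℝ), (∀ φ : ι → ℝ, HasDerivAt (fun t : ℝ => G (Function.update φ q t)) (G' φ) (φ q)) → Integrable G → Integrable G' → ∫ φ : ι → ℝ, G' φ = 0 := by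
  intro ι _ _ q G G' hderiv hG hG'
  -- split off the coordinate `q`
  set e := MeasurableEquiv.piEquivPiSubtypeProd (fun _ : ι => ℝ) (fun i => i = q) with he
  have hmp : MeasurePreserving e volume volume := by
    have := volume_preserving_piEquivPiSubtypeProd (fun _ : ι => ℝ) (fun i => i = q)
    convert this using 2
    all_goals (congr; try exact Subsingleton.elim _ _)
  let instU : Unique {i : ι // i = q} := ⟨⟨⟨q, rfl⟩⟩, fun x => Subtype.ext x.2⟩
  set u := @MeasurableEquiv.funUnique {i : ι // i = q} ℝ instU _ with hu
  have hmu : MeasurePreserving u volume volume := by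
    have := @volume_preserving_funUnique {i : ι // i = q} ℝ instU _
    convert this using 2
    all_goals (congr; try exact Subsingleton.elim _ _)
  -- the configuration with coordinate `q` equal to `t` and the other coordinates given by `y`
  set ψ : ℝ → ({i : ι // ¬ i = q} → ℝ) → (ι → ℝ) := fun t y => e.symm (u.symm t, y) with hψ
  have hψ_apply : ∀ (t : ℝ) (y : {i : ι // ¬ i = q} → ℝ) (i : ι),
      ψ t y i = if h : i = q then t else y ⟨i, h⟩ := by
    intro t y i
    simp only [hψ, he, hu, MeasurableEquiv.piEquivPiSubtypeProd, MeasurableEquiv.symm_mk, MeasurableEquiv.coe_mk,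
      Equiv.piEquivPiSubtypeProd_symm_apply, MeasurableEquiv.funUnique]
    by_cases h : i = q
    · rw [dif_pos h, dif_pos h]
      rfl
    · rw [dif_neg h, dif_neg h]
  have hψq : ∀ t y, ψ t y q = t := fun t y => by rw [hψ_apply, dif_pos rfl]
  have hupdate : ∀ (t s : ℝ) (y : {i : ι // ¬ i = q} → ℝ), Function.update (ψ t y) q s = ψ s y := by
    intro t s y
    funext i
    by_cases h : i = q
    · subst h; rw [Function.update_self, hψq]
    · rw [Function.update_of_ne h, hψ_apply, hψ_apply, dif_neg h, dif_neg h]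
  -- transport the integral and apply Fubini with the coordinate `q` innermost
  have h1 : ∫ φ : ι → ℝ, G' φ = ∫ z, G' (e.symm z) := by
    rw [← hmp.symm.integral_comp' (g := G')]
  have hiG : Integrable (fun z => G (e.symm z)) :=
    (hmp.symm.integrable_comp_emb e.symm.measurableEmbedding).2 (by simpa [Function.comp] using hG)
  have hiG' : Integrable (fun z => G' (e.symm z)) :=
    (hmp.symm.integrable_comp_emb e.symm.measurableEmbedding).2 (by simpa [Function.comp] using hG')
  rw [Measure.volume_eq_prod] at h1 hiG hiG'
  rw [h1, integral_prod_symm _ hiG']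
  -- slices are integrable for a.e. `y`
  have hae := (hiG.prod_left_ae).and (hiG'.prod_left_ae)
  refine (integral_congr_ae (hae.mono fun y hy => ?_)).trans (integral_zero _ _)
  obtain ⟨hyG, hyG'⟩ := hy
  -- inner integral over the coordinate `q`, moved to `ℝ`
  show ∫ x, G' (e.symm (x, y)) = (0 : ℝ)
  have hinner : ∫ x, G' (e.symm (x, y)) = ∫ t : ℝ, G' (ψ t y) := by
    rw [← hmu.symm.integral_comp' (g := fun x => G' (e.symm (x, y)))]
  rw [hinner]
  refine integral_eq_zero_of_hasDerivAt_of_integrable (f := fun t => G (ψ t y)) (fun t => ?_) ?_ ?_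
  · have h := hderiv (ψ t y)
    rw [hψq] at h
    simpa only [hupdate] using h
  · exact (hmu.symm.integrable_comp_emb u.symm.measurableEmbedding).2 hyG'
  · exact (hmu.symm.integrable_comp_emb u.symm.measurableEmbedding).2 hyG

/-- The quadratic form along one coordinate: `Q(φ[q ↦ t]) = φᵀPφ + 2(t − φ_q)(Pφ)_q + (t − φ_q)² P_qq`
for symmetric `P`. -/
private lemma quadForm_update_eq {ι : Type} [Fintype ι] [DecidableEq ι] (P : Matrix ι ι ℝ) (hP : P.IsSymm)
    (φ : ι → ℝ) (q : ι) (t : ℝ) :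
    (Function.update φ q t) ⬝ᵥ (P *ᵥ Function.update φ q t) =
      φ ⬝ᵥ (P *ᵥ φ) + 2 * (t - φ q) * (P *ᵥ φ) q + (t - φ q) ^ 2 * P q q := by
  have hupd : Function.update φ q t = φ + (t - φ q) • (Pi.single q (1 : ℝ)) := by
    funext i
    by_cases h : i = q
    · subst h; simp
    · simp [h]
  have hsymm : ∀ u v : ι → ℝ, u ⬝ᵥ (P *ᵥ v) = v ⬝ᵥ (P *ᵥ u) := fun u v => by
    rw [Matrix.dotProduct_mulVec, ← Matrix.mulVec_transpose, hP.eq, dotProduct_comm]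
  rw [hupd, Matrix.mulVec_add, Matrix.mulVec_smul, add_dotProduct, dotProduct_add, dotProduct_add,
    smul_dotProduct, smul_dotProduct, dotProduct_smul, dotProduct_smul,
    hsymm φ (Pi.single q 1), single_one_dotProduct, single_one_dotProduct, Matrix.mulVec_single_one,
    Matrix.col_apply]
  simp only [smul_eq_mul]
  ring

/-- **Gaussian integration by parts (Wick's rule, coordinate form).** For a symmetric precision
matrix `P` on `ι → ℝ` and `F` differentiable along the coordinate `q` (partial derivative `F'`),
`∫ F' e^{−½φᵀPφ} dφ = ∫ F(φ) (Pφ)_q e^{−½φᵀPφ} dφ`, under the natural integrability hypotheses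
(the boundary term vanishes: `integral_partialDeriv_eq_zero`).  Multiplying by `P⁻¹` and summing
over `q` gives `∫ φ_p F = Σ_q P⁻¹_{pq} ∫ ∂_q F` for the Debye–Hückel Gaussian — the engine of every
perturbative step around it. [folklore] -/
theorem gaussian_ibp :
    ∀ (ι : Type) [Fintype ι] [DecidableEq ι] (P : Matrix ι ι ℝ), P.IsSymm → ∀ (q : ι) (F F' : (ι → ℝ) → ℝ), (∀ φ : ι → ℝ, HasDerivAt (fun t : ℝ => F (Function.update φ q t)) (F' φ) (φ q)) → Integrable (fun φ : ι → ℝ => F φ * Real.exp (-(φ ⬝ᵥ (P *ᵥ φ)) / 2)) → Integrable (fun φ : ι → ℝ => F' φ * Real.exp (-(φ ⬝ᵥ (P *ᵥ φ)) / 2)) → Integrable (fun φ : ι → ℝ => F φ * (P *ᵥ φ) q * Real.exp (-(φ ⬝ᵥ (P *ᵥ φ)) / 2)) → ∫ φ : ι → ℝ, F' φ * Real.exp (-(φ ⬝ᵥ (P *ᵥ φ)) / 2) = ∫ φ : ι → ℝ, F φ * (P *ᵥ φ) q * Real.exp (-(φ ⬝ᵥ (P *ᵥ φ)) / 2) :=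 by
  intro ι _ _ P hP q F F' hF hiF hiF' hiFP
  set w : (ι → ℝ) → ℝ := fun φ => Real.exp (-(φ ⬝ᵥ (P *ᵥ φ)) / 2) with hw
  -- derivative of the Gaussian weight along the coordinate `q`
  have hwderiv : ∀ φ : ι → ℝ, HasDerivAt (fun t : ℝ => w (Function.update φ q t)) (w φ * (-(P *ᵥ φ) q)) (φ q) := by
    intro φ
    have h1 : HasDerivAt (fun t : ℝ => t - φ q) 1 (φ q) := (hasDerivAt_id (φ q)).sub_const (φ q)
    have h3 := ((h1.const_mul 2).mul_const ((P *ᵥ φ) q)).const_add (φ ⬝ᵥ (P *ᵥ φ))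
    have h4 := (h1.fun_pow 2).mul_const (P q q)
    have h2 : HasDerivAt (fun t : ℝ => φ ⬝ᵥ (P *ᵥ φ) + 2 * (t - φ q) * (P *ᵥ φ) q + (t - φ q) ^ 2 * P q q)
        (2 * (P *ᵥ φ) q) (φ q) := (h3.fun_add h4).congr_deriv (by simp)
    have h6 := (h2.const_mul (-2⁻¹)).exp
    have hfun : (fun t : ℝ => w (Function.update φ q t)) = fun t =>
        Real.exp (-2⁻¹ * (φ ⬝ᵥ (P *ᵥ φ) + 2 * (t - φ q) * (P *ᵥ φ) q + (t - φ q) ^ 2 * P q q)) := by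
      funext t
      simp only [hw, quadForm_update_eq P hP φ q t]
      congr 1
      ring
    rw [hfun]
    refine h6.congr_deriv ?_
    simp only [hw, sub_self, mul_zero, zero_mul, add_zero, ne_eq, OfNat.ofNat_ne_zero, not_false_eq_true, zero_pow]
    rw [show (-2⁻¹ : ℝ) * (φ ⬝ᵥ (P *ᵥ φ)) = -(φ ⬝ᵥ (P *ᵥ φ)) / 2 by ring]
    ring
  -- apply the divergence lemma to `G = F · w`
  have hG := integral_partialDeriv_eq_zero ι q (fun φ => F φ * w φ)
    (fun φ => F' φ * w φ - F φ * (P *ᵥ φ) q * w φ) (fun φ => ?_) hiF ?_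
  · have hsplit : ∫ φ : ι → ℝ, (F' φ * w φ - F φ * (P *ᵥ φ) q * w φ) =
        (∫ φ : ι → ℝ, F' φ * w φ) - ∫ φ : ι → ℝ, F φ * (P *ᵥ φ) q * w φ := integral_sub hiF' hiFP
    rw [hsplit] at hG
    linarith
  · have h := (hF φ).fun_mul (hwderiv φ)
    rw [Function.update_eq_self] at h
    exact h.congr_deriv (by ring)
  · exact hiF'.sub hiFP

end

end Summit.QuantumFields.YangMills.Theorems.AnchorGap

end
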